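import Summits.QuantumFields.YangMills.Theorems.EntropyBudgetEquipartitionSpecificHeatSumRule
import Summits.QuantumFields.YangMills.Theorems.EntropyBudgetEquipartitionSpecificHeatEquipartition
import Summits.QuantumFields.YangMills.Theorems.EntropyBudgetEquipartitionFreeEnergyRate
import HarnessLib

/-!
# Route `EntropyBudgetEquipartition`, crux `EntropyBudgetTransfer` (stmt-QuantumFields-22401) — the specific-heat sum rule and equipartition, UNCONDITIONAL for all compact simple `G`

HONEST LABEL: a helper toward a RECORD-label rung (R2ξ-G); nothing here bears on the Yang–Mills mass
gap itself.

The conditional theorems of `EntropyBudgetEquipartitionSpecificHeatSumRule.lean` /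
`EntropyBudgetEquipartitionSpecificHeatEquipartition.lean` take the body of crux `FreeEnergyRate` (K1) as a
hypothesis; K1 is CLOSED in the tree (`Summit.QuantumFields.YangMills.Theorems.freeEnergyRate_proof`,
Chatterjee's free-energy asymptotics with a power rate for every compact simple `G`). Discharging it:

* `specificHeat_sumRule` — for every compact simple `G` and lattice representation `r` (`d = 4`,
  `D = dim 𝔤_r` typed as in the crux) there are `κ > 0`, `C'`, `β₁ > 0` with: for all `β₁ ≤ β ≤ β'`,
  eventually along the tori `Λ_{L+1}`,
  `|∫_β^{β'} |Λ_{L+1}|⁻¹ Var_{t,L+1}(S_W) dt − (3D/2)(1/β − 1/β')| ≤ C' (β^{−(1+κ/2)} + β'^{−(1+κ/2)})`;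
* `exists_coupling_equipartition` — … and `C''`, `β₂ > 0` with: for every `β ≥ β₂`, eventually in `L`, some
  coupling `t ∈ [β, β + β·β^{−κ/4}]` has `|t² |Λ_{L+1}|⁻¹ Var_{t,L+1}(S_W) − 3D/2| ≤ C'' β^{−κ/4}`.

This file imports a module above the route file `Theses/EntropyBudgetEquipartition.lean` (the closed crux
lives there); the route-independent mathematics is in the two sibling files.

References: S. Chatterjee, arXiv:1602.01222, Thm. 2.1; S. Friedli, Y. Velenik, *Statistical Mechanics of
Lattice Systems*, CUP 2017, §3.2. [arXiv160201222] [FriedliVelenik2017]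
-/

noncomputable section

namespace Summit.QuantumFields.YangMills.Theorems.EntropyBudgetEquipartition.SpecificHeat

open MeasureTheory ProbabilityTheory Filter Topology Set
open Literature.MathematicalPhysics.QuantumLattice Literature.MathematicalPhysics.QuantumFieldTheory

/-- **Specific-heat sum rule with a power rate — unconditional** (every compact simple `G`, every lattice
representation `r`, `d = 4`; `D = dim 𝔤_r` typed as in crux `FreeEnergyRate`): there are `κ > 0`, `C'` and
`β₁ > 0` such that for all `β₁ ≤ β ≤ β'`, eventually along the tori `Λ_{L+1}`,
`|∫_β^{β'} |Λ_{L+1}|⁻¹ Var_{t,L+1}(S_W) dt − (3D/2)(1/β − 1/β')| ≤ C' (β^{−(1+κ/2)} + β'^{−(1+κ/2)})`: the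
`β`-integrated specific heat per site of 4-d lattice Yang–Mills has the free-gluon equipartition value up to a
power (`freeEnergyRate_proof` fed into `specificHeat_sumRule_of_rate`). Not a statement about the mass gap. [cite: arXiv160201222, Thm. 2.1] -/
theorem specificHeat_sumRule (G : Type) [Group G] [TopologicalSpace G] [IsTopologicalGroup G]
    [CompactSpace G] (hG : IsCompactSimpleLieGroup G) :
    letI : MeasurableSpace G := borel G
    haveI : BorelSpace G := ⟨rfl⟩
    ∀ r : LatticeRep G, ∃ κ C' β₁ : ℝ, 0 < κ ∧ 0 < β₁ ∧
      ∀ β β' : ℝ, β₁ ≤ β → β ≤ β' → ∀ᶠ L : ℕ in atTop,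
        |(∫ t in β..β', (((L + 1 : ℕ) : ℝ) ^ 4)⁻¹ *
            Var[wilsonAction (d := 4) (L := L + 1) (G := G) r.ρ;
              wilsonMeasure (d := 4) (L := L + 1) r.ρ t]) -
            (3 * (Module.finrank ℝ ↥(Submodule.span ℝ {X : Matrix (Fin r.N) (Fin r.N) ℂ |
              ∀ t : ℝ, NormedSpace.exp ((t : ℂ) • X) ∈ Set.range r.ρ}) : ℝ) / 2) *
              (1 / β - 1 / β')| ≤
          C' * (β ^ (-(1 + κ / 2)) + β' ^ (-(1 + κ / 2))) := by
  letI : MeasurableSpace G := borel G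
  haveI : BorelSpace G := ⟨rfl⟩
  intro r
  obtain ⟨K, κ, C, β₀, hκ, hrate⟩ := freeEnergyRate_proof G hG r
  obtain ⟨C', β₁, hβ₁, h⟩ := specificHeat_sumRule_of_rate r hκ hrate
  exact ⟨κ, C', β₁, hκ, hβ₁, h⟩

/-- **Equipartition of the specific heat at a nearby coupling — unconditional** (every compact simple `G`,
every lattice representation `r`, `d = 4`): there are `κ > 0`, `C''` and `β₂ > 0` such that for every
`β ≥ β₂`, eventually along the tori `Λ_{L+1}`, some coupling `t ∈ [β, β + β·β^{−κ/4}]` has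
`|t² · |Λ_{L+1}|⁻¹ Var_{t,L+1}(S_W) − 3D/2| ≤ C'' β^{−κ/4}` — the specific heat per site of 4-d lattice
Yang–Mills takes the free-gluon value `3D/(2t²)` up to a power at a coupling within `β^{1−κ/4}` of every large
`β` (`freeEnergyRate_proof` fed into `exists_coupling_equipartition_of_rate`). Pointwise-in-`β` equipartition
is not claimed; not a statement about the mass gap. [cite: arXiv160201222, Thm. 2.1] -/
theorem exists_coupling_equipartition (G : Type) [Group G] [TopologicalSpace G] [IsTopologicalGroup G]
    [CompactSpace G] (hG : IsCompactSimpleLieGroup G) :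
    letI : MeasurableSpace G := borel G
    haveI : BorelSpace G := ⟨rfl⟩
    ∀ r : LatticeRep G, ∃ κ C'' β₂ : ℝ, 0 < κ ∧ 0 < β₂ ∧
      ∀ β : ℝ, β₂ ≤ β → ∀ᶠ L : ℕ in atTop, ∃ t : ℝ,
        β ≤ t ∧ t ≤ β + β * β ^ (-(κ / 4)) ∧
          |t ^ 2 * ((((L + 1 : ℕ) : ℝ) ^ 4)⁻¹ *
              Var[wilsonAction (d := 4) (L := L + 1) (G := G) r.ρ;
                wilsonMeasure (d := 4) (L := L + 1) r.ρ t]) -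
              3 * (Module.finrank ℝ ↥(Submodule.span ℝ {X : Matrix (Fin r.N) (Fin r.N) ℂ |
                ∀ t : ℝ, NormedSpace.exp ((t : ℂ) • X) ∈ Set.range r.ρ}) : ℝ) / 2| ≤
            C'' * β ^ (-(κ / 4)) := by
  letI : MeasurableSpace G := borel G
  haveI : BorelSpace G := ⟨rfl⟩
  intro r
  obtain ⟨K, κ, C, β₀, hκ, hrate⟩ := freeEnergyRate_proof G hG r
  obtain ⟨C'', β₂, hβ₂, h⟩ := exists_coupling_equipartition_of_rate r hκ hrate
  exact ⟨κ, C'', β₂, hκ, hβ₂, h⟩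

end Summit.QuantumFields.YangMills.Theorems.EntropyBudgetEquipartition.SpecificHeat

end
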